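import Mathlib
import Literature.Analysis.FluidPDE.Tao2016AveragedNS.ShiftSetCascadeFlows
import Literature.Analysis.FluidPDE.Tao2016AveragedNS.ShiftSetCascadeFlux
import Summits.NavierStokesRegularity.NavierStokesRegularity.Theorems.TaoLadderRungTwoFlatMirrorTableDefs
import Summits.NavierStokesRegularity.NavierStokesRegularity.Theorems.TaoLadderRungTwoFlatPulseDefs
import Summits.NavierStokesRegularity.NavierStokesRegularity.Theorems.TaoLadderRungTwoFlatGaugeGronwall
import Summits.NavierStokesRegularity.NavierStokesRegularity.Theorems.TaoLadderRungTwoFlatNonlinearHop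
import Summits.NavierStokesRegularity.NavierStokesRegularity.Theorems.TaoLadderRungTwoFlatHopRenormalisation
import Summits.NavierStokesRegularity.NavierStokesRegularity.Theorems.TaoLadderRungTwoFlatGaugeCaptureDefs
import HarnessLib

/-!
# ONE VALIDATED HOP in the GEOMETRIC GAUGE of SPLIT-T48: `HopContractionWith ε τ Φ (geomGauge g b) ρ C N` ⟹ the
  nonlinear one-hop tube invariance around the pulse family, all structural gauge hypotheses discharged
  (helper for item stmt-NavierStokesRegularity-22987 `FlatGapCertificatesV2`, crux K_A♭ of route TaoLadderRungTwoFlat;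
  cell harvest/h2-tao-ladder, p1 g20 — the λ₀ = 1 consumer of child 1 of theory-1 g36's SPLIT-T48)

With `ω := geomGauge g b` (growth `g` ahead, decay `b` behind) and the head gauge `w := headGauge g` (`= g^{k⁺}`),
theory-1's `…GaugeCaptureDefs` provides `IsWindowRegular w g`, `IsWindowAdmissible w g` and `ω ≤ w(·+N)` (`Γ = 1`), and
`…HopRenormalisation.hop_renormalisation` then gives, by shift-periodicity of the pulse:

* `MirrorPulse.pulse_hop_geom` — **for a shift-periodic exact solution `Φ` of `T♭(ε)` with
  `HopContractionWith ε τ Φ (geomGauge g b) ρ C N` (`g, b ≥ 1`) and a head-gauge bound `g^{k⁺}|Φ_k| ≤ M_w` on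
  `[Nτ − 1, Nτ + 1]`, every bounded exact `X` with `geomGauge|X(0) − Φ(0)| ≤ B`, `headGauge|X(0) − Φ(0)| ≤ B̃`, `CB ≤ ½`,
  satisfies `geomGauge g b _ k · |X_{i,k+N}(Nτ) − κΦ_{i,k}(h)| ≤ ρB + ‖T♭‖₁g(B̃e^{L'Nτ})²Nτe^{L'Nτ} + 12C²B²‖T♭‖₁²g²M_w³`
  for some `|κ − 1| ≤ CB`, `|h| ≤ 2CB`** (`L' = 2‖T♭‖₁Mg`): after `N` hops the perturbed solution is back in the tube
  around the pulse family, radius `ρB + O(B² + B̃²)`.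

HONEST FRAMING: a conditional perturbation lemma about a MODEL lattice (no pulse constructed, no contraction certified);
nothing about the Navier–Stokes equations.
-/

noncomputable section

-- the sub-problem namespace repeats the summit name by design (D-0017)
set_option linter.dupNamespace false

namespace Summit.NavierStokesRegularity.NavierStokesRegularity.Theorems

open Set Filter Literature.Analysis.FluidPDE Literature.Analysis.FluidPDE.TaoCascade
open scoped Topology

namespace MirrorPulse

open QuadPolar

/-- **ONE VALIDATED HOP IN THE GEOMETRIC GAUGE (λ₀ = 1, SPLIT-T48 shape).** See the module docstring.
[cite: Tao2016AveragedNS, §4 (4.8) and §6.3–6.4 (statement shape of a hop certificate); route TaoLadderRungTwoFlat, analytic lane L3 at λ₀ = 1] -/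
theorem pulse_hop_geom {ε τ : ℝ} {Φ X : Fin 2 → ℤ → ℝ → ℝ} {g b ρ C M Mw B B' : ℝ} {N : ℕ}
    (hΦ : IsGlobalSol ε Φ) (hper : IsShiftPeriodic τ Φ) (hτ : 0 ≤ τ) (hX : IsGlobalSol ε X)
    (hΦb : ∀ i n t, |Φ i n t| ≤ M) (hXb : ∀ i n t, |X i n t| ≤ M) (hg : 1 ≤ g) (hb : 1 ≤ b)
    (hS2 : HopContractionWith ε τ Φ (geomGauge g b) ρ C N) (hMw : 0 ≤ Mw)
    (hΦg : ∀ j k, ∀ t ∈ Icc ((N : ℝ) * τ - 1) ((N : ℝ) * τ + 1), headGauge g j k * |Φ j k t| ≤ Mw)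
    (hB : ∀ i k, geomGauge g b i k * |X i k 0 - Φ i k 0| ≤ B)
    (hB' : ∀ i k, headGauge g i k * |X i k 0 - Φ i k 0| ≤ B') (hCB : C * B ≤ 1 / 2) :
    ∃ κ h : ℝ, |κ - 1| ≤ C * B ∧ |h| ≤ 2 * (C * B) ∧
      ∀ (i : Fin 2) (k : ℤ), geomGauge g b i k * |X i (k + N) (N * τ) - κ * Φ i k h| ≤
        ρ * B + 1 * (tableAbsSum shiftSetFlat (mirrorTable ε ε) * g *
          (B' * Real.exp (2 * tableAbsSum shiftSetFlat (mirrorTable ε ε) * M * g * (N * τ))) ^ 2 * (N * τ) *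
            Real.exp (2 * tableAbsSum shiftSetFlat (mirrorTable ε ε) * M * g * (N * τ)) +
          12 * (C * B) ^ 2 * ((tableAbsSum shiftSetFlat (mirrorTable ε ε)) ^ 2 * g ^ 2 * Mw ^ 3)) := by
  obtain ⟨hωpos, -, -, -, -, hbody⟩ := hS2
  have hT : 0 ≤ (N : ℝ) * τ := by positivity
  have hw : IsWindowRegular (headGauge g) g := isWindowRegular_headGauge hg
  have hA : IsWindowAdmissible (headGauge g) g := isWindowAdmissible_headGauge hg
  have hΓ : ∀ i k, geomGauge g b i k ≤ 1 * headGauge g i (k + (N : ℤ)) := fun i k =>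
    geomGauge_le_headGauge_shift hg hb i k N
  have hlin : ∀ u : Fin 2 → ℤ → ℝ → ℝ,
      (∀ i n t, HasDerivAt (u i n) (linTermOn shiftSetFlat 0 (mirrorTable ε ε) Φ u i n t) t) →
      (∃ Mu : ℝ, ∀ i n, ∀ t ∈ Icc 0 ((N : ℝ) * τ), |u i n t| ≤ Mu) →
      (∀ i k, geomGauge g b i k * |u i k 0| ≤ B) →
        ∃ c₁ c₂ : ℝ, |c₁| ≤ C * B ∧ |c₂| ≤ C * B ∧
          ∀ i k, geomGauge g b i k * |u i (k + (N : ℤ)) ((N : ℝ) * τ)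
            - c₁ * quadTermOn shiftSetFlat 0 (mirrorTable ε ε) Φ i (k + (N : ℤ)) ((N : ℝ) * τ)
            - c₂ * Φ i (k + (N : ℤ)) ((N : ℝ) * τ)| ≤ ρ * B := by
    intro u hud hub hBu
    exact hbody u B ⟨hud, hub⟩ hBu
  obtain ⟨κ, h, hκ, hh, hest⟩ := hop_renormalisation isNearestNeighbourSet_shiftSetFlat (mirrorTable ε ε) hw hA
    (fun i k => (hωpos i k).le) (N := (N : ℤ)) hΓ hT hMw hΦ hX hΦb hXb hΦg hlin hB hB' hCB
  refine ⟨κ, h, hκ, hh, fun i k => ?_⟩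
  have hshift : Φ i (k + (N : ℤ)) ((N : ℝ) * τ + h) = Φ i k h := by
    rw [add_comm ((N : ℝ) * τ) h]
    exact isShiftPeriodic_iterate hper N i k h
  have h1 := hest i k
  rw [hshift] at h1
  exact h1

end MirrorPulse

end Summit.NavierStokesRegularity.NavierStokesRegularity.Theorems

end
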